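import Summits.FinalStateConjecture.FinalStateConjecture.Theorems.DerivativeThriftThriftyClusterSettlingSplitting
import Summits.FinalStateConjecture.FinalStateConjecture.Theorems.ThriftyClusterSettling.Negative.ThriftyClusterSettlingFalseOfKerrStableNonOuterFlatThriftyMGHD
import HarnessLib

/-!
# Crux `ThriftyClusterSettling` (stmt-FinalStateConjecture-17611, route DerivativeThrift): the HINGE of the
# item as filed — its truth value is a function of `ThriftyKerrStability` (stmt-17610) and ONE witness

Six successive line leads found the only line of this crux dead at `stub_outerZoneFlatness`; the kernel record so
far is the exact splitting `ThriftyClusterSettling ↔ RepairA ∧ ForcedOuterFlatness` (p153616) and the negative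
lemma modulo `H = KerrStableNonOuterFlatThriftyMGHD` (p151567).  This file closes the bookkeeping by recording,
as propositions, WHY no closing move on the item as filed exists before stmt-FinalStateConjecture-17610
(`ThriftyKerrStability`, the crux's own hypothesis) is settled, and what the item as filed is worth after that:

* `thriftyKerrStability_of_not_thriftyClusterSettling` : `¬ ThriftyClusterSettling → ThriftyKerrStability` — a
  refutation of the crux as filed PROVES item 17610 (so none can land first);
* `thriftyClusterSettling_of_not_thriftyKerrStability` : `¬ ThriftyKerrStability → ThriftyClusterSettling` — a
  refutation of 17610 as filed (the same thrift order `k = 2`) closes this item `proved`, vacuously;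
  `thriftyClusterSettling_or_thriftyKerrStability` is the disjunction form;
* `forcedOuterFlatness_iff_not_kerrStableNonOuterFlatThriftyMGHD` : the unfed conjunct of the splitting is
  EXACTLY the non-existence of the negative lane's witness, `ForcedOuterFlatness ↔ ¬ H`;
* `thriftyClusterSettling_iff_repairA_and_not_witness` : `ThriftyClusterSettling ↔ RepairA ∧ ¬ H` — the crux as
  filed is its recorded repair PLUS the claim that no Kerr-stable thrifty MGHD fails outer-zone flatness;
* `not_thriftyClusterSettling_iff` : `¬ ThriftyClusterSettling ↔ H ∨ ¬ RepairA` — it fails iff the documented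
  witness exists or the repaired statement itself fails.

Pure logic over p153616/p151567; no analysis is claimed.  On paper (line dossiers `Lines/registered-dead*.md`,
refuter CRUX-ATTACK.md) the far-field focusing packets that inhabit `H` given `ThriftyKerrStability` are the same
`k = 2` packets that defeat `ThriftyKerrStability` itself, so the paper value of the item as filed is "vacuously
true iff 17610 is false" — either way it is decided by 17610 first, which is the content of the first two lemmas.
Chart vocabulary: DHRT arXiv:2104.08222, §1; Dafermos–Luk arXiv:1710.01722, Conjecture 1.
Line lead prover-line-stmt-FinalStateConjecture-17611-c6-0, 2026-08-17.
-/

noncomputable section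

-- the doubled `FinalStateConjecture` path component is the summit/problem naming scheme
set_option linter.dupNamespace false

namespace Summit.FinalStateConjecture.FinalStateConjecture.Theorems.DerivativeThrift.ThriftyClusterSettling

open Set Filter Topology TopologicalSpace
open scoped Manifold ContDiff ENNReal
open Literature.Geometry.Lorentzian

/-- **A refutation of the crux as filed proves `ThriftyKerrStability`.**  The crux is an implication out of
`ThriftyKerrStability` (item stmt-FinalStateConjecture-17610); the negation of an implication yields its
hypothesis.  Hence the item cannot close `refuted` before 17610 closes `proved`. [folklore] -/
theorem thriftyKerrStability_of_not_thriftyClusterSettling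
    (h : ¬ Theses.DerivativeThrift.ThriftyClusterSettling) : Theses.DerivativeThrift.ThriftyKerrStability := by
  by_contra hK
  exact h fun hK' => (hK hK').elim

/-- **A refutation of `ThriftyKerrStability` proves the crux as filed (vacuously).**  If item 17610 closes
`refuted` at the filed thrift order, this item closes `proved` by this one-liner. [folklore] -/
theorem thriftyClusterSettling_of_not_thriftyKerrStability
    (hK : ¬ Theses.DerivativeThrift.ThriftyKerrStability) : Theses.DerivativeThrift.ThriftyClusterSettling :=
  fun hK' => (hK hK').elim

/-- **Disjunction form of the hinge**: the crux as filed or its own hypothesis holds. [folklore] -/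
theorem thriftyClusterSettling_or_thriftyKerrStability :
    Theses.DerivativeThrift.ThriftyClusterSettling ∨ Theses.DerivativeThrift.ThriftyKerrStability := by
  by_cases hK : Theses.DerivativeThrift.ThriftyKerrStability
  · exact Or.inr hK
  · exact Or.inl (thriftyClusterSettling_of_not_thriftyKerrStability hK)

/-- **The unfed conjunct is exactly the absence of the negative lane's witness.**
`ForcedOuterFlatness ↔ ¬ KerrStableNonOuterFlatThriftyMGHD`: "granted `ThriftyKerrStability`, every maximal
development of admissible data with complete `𝓘⁺` and a thrifty hand-over is outer-flat" holds iff there is no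
pair (thrifty Kerr stability, thrifty MGHD without an outer-zone flatness certificate).  (→) feed the witness to the
conjunct; (←) classical contraposition.  DHRT arXiv:2104.08222, §1 (chart vocabulary). [folklore] -/
theorem forcedOuterFlatness_iff_not_kerrStableNonOuterFlatThriftyMGHD :
    (Theses.DerivativeThrift.ThriftyKerrStability → ∀ (X : Type) [TopologicalSpace X] [ChartedSpace E3 X] [IsManifold (𝓡 3) ∞ X] [T2Space X] [SecondCountableTopology X] [ConnectedSpace X] (D : InitialDataSet (𝓡 3) X), D ∈ admissibleVacuumData X → ∀ 𝒟 : VacuumCauchyDevelopment D, 𝒟.IsMaximal → HasCompleteNullInfinity 𝒟.toCauchyDevelopment → Theorems.DerivativeThriftThriftyHandoff.FullHandoff 𝒟 → ∃ (θ τₑ : ℝ) (V : Opens E4) (Φₑ : V → 𝒟.carrier), 0 < θ ∧ {x : E4 | τₑ < x 0 ∧ (1 - θ) * x 0 < E4.spatialNorm x} ⊆ (V : Set E4) ∧ 𝒟.toSpacetime.IsLateChart (Minkowski.backgroundOn V) (𝒟.metric.causalFuture 𝒟.timeOrientation (Set.range 𝒟.embed)) τₑ Φₑ ∧ Tendsto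 (fun τ ↦ 𝒟.toSpacetime.deviationCk (Minkowski.backgroundOn V) Φₑ 2 τ) atTop (𝓝 0) ∧ ∀ᶠ τ in atTop, ∀ x ∈ (Minkowski.backgroundOn V).timeSlab τ, 𝒟.timeOrientation.IsFutureDirected (mfderiv 𝓘(ℝ, E4) (𝓡 4) Φₑ x (E4.basisVector 0))) ↔
      ¬ Theorems.ThriftyClusterSettling.Negative.KerrStableNonOuterFlatThriftyMGHD := by
  constructor
  · rintro hF ⟨hK, X, _, _, _, _, _, _, D, 𝒟, hD, h𝒟, h𝓘, hH, hno⟩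
    exact hno (hF hK X D hD 𝒟 h𝒟 h𝓘 hH)
  · intro hno hK X _ _ _ _ _ _ D hD 𝒟 h𝒟 h𝓘 hH
    by_contra hc
    exact hno ⟨hK, X, ‹_›, ‹_›, ‹_›, ‹_›, ‹_›, ‹_›, D, 𝒟, hD, h𝒟, h𝓘, hH, hc⟩

/-- **The crux as filed = its recorded repair + "no Kerr-stable thrifty MGHD fails outer-zone flatness".**
`ThriftyClusterSettling ↔ RepairA ∧ ¬ KerrStableNonOuterFlatThriftyMGHD`, from the exact splitting
`thriftyClusterSettling_iff_repairA_and_forcedOuterFlatness` (p153616) and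
`forcedOuterFlatness_iff_not_kerrStableNonOuterFlatThriftyMGHD`.  `RepairA` is the crux with the outer-zone
flatness certificate added to its antecedent (registrar's recorded repair, `Cruxes/ThriftyClusterSettling/Lines/
registered.lean`, Appendix).  Dafermos–Luk arXiv:1710.01722, Conjecture 1; DHRT arXiv:2104.08222, §1. [folklore] -/
theorem thriftyClusterSettling_iff_repairA_and_not_witness :
    Theses.DerivativeThrift.ThriftyClusterSettling ↔
      (Theses.DerivativeThrift.ThriftyKerrStability → ∀ (X : Type) [TopologicalSpace X] [ChartedSpace E3 X] [IsManifold (𝓡 3) ∞ X] [T2Space X] [SecondCountableTopology X] [ConnectedSpace X] (D : InitialDataSet (𝓡 3) X), D ∈ admissibleVacuumData X → ∀ 𝒟 : VacuumCauchyDevelopment D, 𝒟.IsMaximal → HasCompleteNullInfinity 𝒟.toCauchyDevelopment → Theorems.DerivativeThriftThriftyHandoff.FullHandoff 𝒟 → (∃ (θ τₑ : ℝ) (V : Opens E4) (Φₑ : V → 𝒟.carrier), 0 < θ ∧ {x : E4 | τₑ < x 0 ∧ (1 - θ) * x 0 < E4.spatialNorm x} ⊆ (V : Set E4) ∧ 𝒟.toSpacetime.IsLateChart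 (Minkowski.backgroundOn V) (𝒟.metric.causalFuture 𝒟.timeOrientation (Set.range 𝒟.embed)) τₑ Φₑ ∧ Tendsto (fun τ ↦ 𝒟.toSpacetime.deviationCk (Minkowski.backgroundOn V) Φₑ 2 τ) atTop (𝓝 0) ∧ ∀ᶠ τ in atTop, ∀ x ∈ (Minkowski.backgroundOn V).timeSlab τ, 𝒟.timeOrientation.IsFutureDirected (mfderiv 𝓘(ℝ, E4) (𝓡 4) Φₑ x (E4.basisVector 0))) → ∃ (O : Set 𝒟.carrier) (d : FinalStateDecomposition 𝒟.toSpacetime O 2), (∀ i, Kerr.IsSubextremal (d.mass i) (d.spin i)) ∧ O = exteriorOf 𝒟.toCauchyDevelopment d.charted ∧ HasExhaustiveCharts d ∧ IsFutureOriented d) ∧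
      ¬ Theorems.ThriftyClusterSettling.Negative.KerrStableNonOuterFlatThriftyMGHD :=
  thriftyClusterSettling_iff_repairA_and_forcedOuterFlatness.trans
    (Iff.rfl.and forcedOuterFlatness_iff_not_kerrStableNonOuterFlatThriftyMGHD)

/-- **Dichotomy of failure.**  `¬ ThriftyClusterSettling ↔ KerrStableNonOuterFlatThriftyMGHD ∨ ¬ RepairA`: the crux
as filed fails iff the documented witness of the negative lane exists (thrifty Kerr stability together with one
thrifty MGHD without an outer-zone flatness certificate) or the repaired statement itself fails.  Classical
rearrangement of `thriftyClusterSettling_iff_repairA_and_not_witness`. [folklore] -/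
theorem not_thriftyClusterSettling_iff :
    ¬ Theses.DerivativeThrift.ThriftyClusterSettling ↔
      Theorems.ThriftyClusterSettling.Negative.KerrStableNonOuterFlatThriftyMGHD ∨
      ¬ (Theses.DerivativeThrift.ThriftyKerrStability → ∀ (X : Type) [TopologicalSpace X] [ChartedSpace E3 X] [IsManifold (𝓡 3) ∞ X] [T2Space X] [SecondCountableTopology X] [ConnectedSpace X] (D : InitialDataSet (𝓡 3) X), D ∈ admissibleVacuumData X → ∀ 𝒟 : VacuumCauchyDevelopment D, 𝒟.IsMaximal → HasCompleteNullInfinity 𝒟.toCauchyDevelopment → Theorems.DerivativeThriftThriftyHandoff.FullHandoff 𝒟 → (∃ (θ τₑ : ℝ) (V : Opens E4) (Φₑ : V → 𝒟.carrier), 0 < θ ∧ {x : E4 | τₑ < x 0 ∧ (1 - θ) * x 0 < E4.spatialNorm x} ⊆ (V : Set E4) ∧ 𝒟.toSpacetime.IsLateChart (Minkowski.backgroundOn V) (𝒟.metric.causalFuture 𝒟.timeOrientation (Set.range 𝒟.embed)) τₑ Φₑ ∧ Tendsto (fun τ ↦ 𝒟.toSpacetime.deviationCk (Minkowski.backgroundOn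 V) Φₑ 2 τ) atTop (𝓝 0) ∧ ∀ᶠ τ in atTop, ∀ x ∈ (Minkowski.backgroundOn V).timeSlab τ, 𝒟.timeOrientation.IsFutureDirected (mfderiv 𝓘(ℝ, E4) (𝓡 4) Φₑ x (E4.basisVector 0))) → ∃ (O : Set 𝒟.carrier) (d : FinalStateDecomposition 𝒟.toSpacetime O 2), (∀ i, Kerr.IsSubextremal (d.mass i) (d.spin i)) ∧ O = exteriorOf 𝒟.toCauchyDevelopment d.charted ∧ HasExhaustiveCharts d ∧ IsFutureOriented d) := by
  rw [thriftyClusterSettling_iff_repairA_and_not_witness]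
  tauto

end Summit.FinalStateConjecture.FinalStateConjecture.Theorems.DerivativeThrift.ThriftyClusterSettling

end
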